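import Mathlib
import Summits.PneNP.PneNP.Theorems.OverlapGapAlgebraSolvableImpliesStableSectionTwoWayRepairTreeCompose
import Summits.PneNP.PneNP.Theorems.OverlapGapAlgebraSolvableImpliesStableSectionTwoWayRepairBuildData

/-!
# PneNP / OverlapGapAlgebra — crux `SolvableImpliesStableSection` (stmt-PneNP-2463):
# the TWO-WAY REPAIR block (7b/·) — every violated clause has a good witness tree

Support for crux `stmt-PneNP-2463` (`Summit.PneNP.PneNP.Theses.OverlapGapAlgebra.SolvableImpliesStableSection`):
the f-free block "bounded-round two-way repair with one-round memory gives stable sections for every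
`ν > 0` up to `α ≤ 2^k/(4k)`".  A clause `i` violated at round `t` with nominee `jf` (least slot in
the priority order of `…TwoWayRepairDynamics`) becomes the root, of code `2t + [(i, jf) positive]`, of
a tree code: the nominee slot is left childless; every other slot whose variable flipped at the last
round bears the good code of its nominator at round `t - 1` (`sissW_child_recent`); every other positive
slot bears the good code of an earlier `true → false` flip of its variable (`sissW_child_positive`);
the remaining slots (negative, not flipped at the last round) are childless.  Then the nominee is the
least childless root slot (slots before it have higher priority class), it is the only childless slot
when it is positive, the two-way sign rule holds at the root, and the root is recent (a clause violated
at round `t ≥ 1` was satisfied at round `t - 1`, `sissW_newly_violated`):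

* (`sissW_build_children`, the slot data: `…TwoWayRepairBuildData`); `sissW_build_asm` — the
  assembled code is good;
* `sissW_build` — every clause violated at a round `t ≤ Λ` is the root of a good code of `TS t`
  (codes bounded by `2Λ + 1`).
No definitions (all objects are hypotheses); axioms `propext`, `Classical.choice`, `Quot.sound`.
-/

set_option linter.dupNamespace false -- `Summit.PneNP.PneNP.…`: summit = sub-problem (D-0017)

namespace Summit.PneNP.PneNP.Theorems

open Finset
open scoped Classical

section Build

variable {m k n : ℕ}
/-- **The assembled code of a violated clause is good.** With slot data as in `sissW_build_children`
for clause `i` violated at round `t ≤ Λ` with nominee `jf` (`k ≥ 2`, codes bounded by `2Λ + 1`), the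
code `asm i (2t + [(i, jf) positive]) ch` is a good code for `(i, t)`. -/
theorem sissW_build_asm (asm : Fin m → ℕ → (Fin k → Option (Finset (List (Fin k) × (Fin m × ℕ)))) → Finset (List (Fin k) × (Fin m × ℕ)))
    (hasm : ∀ (c : Fin m) (r : ℕ) (ch : Fin k → Option (Finset (List (Fin k) × (Fin m × ℕ))))
      (e : (List (Fin k) × (Fin m × ℕ))), e ∈ asm c r ch ↔ (e = ([], (c, r)) ∨
      ∃ (j : Fin k) (S : Finset (List (Fin k) × (Fin m × ℕ))), ch j = some S ∧
        ∃ b : List (Fin k), (b, e.2) ∈ S ∧ e.1 = b ++ [j]))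
    (TS : ℕ → Finset (Finset (List (Fin k) × (Fin m × ℕ)))) (Λ : ℕ)
    (hTS0 : ∀ T : Finset (List (Fin k) × (Fin m × ℕ)), T ∈ TS 0 ↔
      ∃ (c : Fin m) (r : ℕ), r ≤ 2 * Λ + 1 ∧ T = asm c r (fun _ => none))
    (hTSs : ∀ (d : ℕ) (T : Finset (List (Fin k) × (Fin m × ℕ))), T ∈ TS (d + 1) ↔
      ∃ (c : Fin m) (r : ℕ), r ≤ 2 * Λ + 1 ∧ ∃ ch : Fin k → Option (Finset (List (Fin k) × (Fin m × ℕ))),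
        (∀ (j : Fin k) (S : Finset (List (Fin k) × (Fin m × ℕ))), ch j = some S → S ∈ TS d) ∧ T = asm c r ch)
    (val : ℕ → (Fin m → Fin k → Fin n × Bool) → Fin n → Bool)
    (hvalW : ∀ (t : ℕ) (Φ : (Fin m → Fin k → Fin n × Bool)) (v : Fin n), val (t + 1) Φ v = val t Φ v ↔
      ¬ (∃ ii : Fin m, (∀ jj : Fin k, val t Φ (Φ ii jj).1 ≠ (Φ ii jj).2) ∧
        ∃ jf : Fin k, (∀ j' : Fin k, (if 1 ≤ t ∧ val t Φ (Φ ii jf).1 ≠ val (t - 1) Φ (Φ ii jf).1 then (2 : ℕ)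
          else if (Φ ii jf).2 = true then 1 else 0) < (if 1 ≤ t ∧ val t Φ (Φ ii j').1 ≠ val (t - 1) Φ (Φ ii j').1 then (2 : ℕ)
          else if (Φ ii j').2 = true then 1 else 0) ∨
        ((if 1 ≤ t ∧ val t Φ (Φ ii jf).1 ≠ val (t - 1) Φ (Φ ii jf).1 then (2 : ℕ)
          else if (Φ ii jf).2 = true then 1 else 0) = (if 1 ≤ t ∧ val t Φ (Φ ii j').1 ≠ val (t - 1) Φ (Φ ii j').1 then (2 : ℕ)
          else if (Φ ii j').2 = true then 1 else 0) ∧ jf ≤ j')) ∧ (Φ ii jf).1 = v))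
    (hk : 2 ≤ k) (Φ : (Fin m → Fin k → Fin n × Bool)) (t : ℕ) (ht : t ≤ Λ) (i : Fin m) (hviol : (∀ jj : Fin k, val t Φ (Φ i jj).1 ≠ (Φ i jj).2)) (jf : Fin k)
    (hnom : (∀ j' : Fin k, (if 1 ≤ t ∧ val t Φ (Φ i jf).1 ≠ val (t - 1) Φ (Φ i jf).1 then (2 : ℕ)
          else if (Φ i jf).2 = true then 1 else 0) < (if 1 ≤ t ∧ val t Φ (Φ i j').1 ≠ val (t - 1) Φ (Φ i j').1 then (2 : ℕ)
          else if (Φ i j').2 = true then 1 else 0) ∨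
        ((if 1 ≤ t ∧ val t Φ (Φ i jf).1 ≠ val (t - 1) Φ (Φ i jf).1 then (2 : ℕ)
          else if (Φ i jf).2 = true then 1 else 0) = (if 1 ≤ t ∧ val t Φ (Φ i j').1 ≠ val (t - 1) Φ (Φ i j').1 then (2 : ℕ)
          else if (Φ i j').2 = true then 1 else 0) ∧ jf ≤ j')))
    (ch : Fin k → Option (Finset (List (Fin k) × (Fin m × ℕ)))) (hch0 : ch jf = none)
    (hch1 : ∀ (j : Fin k) (S : Finset (List (Fin k) × (Fin m × ℕ))), ch j = some S → (∃ (y : Fin m) (s r' : ℕ) (jf' : Fin k), s < t ∧ S ∈ TS s ∧ (([] : List (Fin k)), (y, r')) ∈ S ∧ r' / 2 = s ∧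
      (∀ e ∈ S, ∀ j : Fin k,
      (((Φ e.2.1 j).2 = true ↔ ((∃ (y : Fin m) (s : ℕ), (j :: e.1, (y, s)) ∈ S ∧ s % 2 = 0) ∨
        ((∀ lab : Fin m × ℕ, (j :: e.1, lab) ∉ S) ∧ e.2.2 % 2 = 1))) ∧
      ∀ (y : Fin m) (s : ℕ), (j :: e.1, (y, s)) ∈ S → ∃ j' : Fin k,
        (∀ lab : Fin m × ℕ, (j' :: j :: e.1, lab) ∉ S) ∧
        (∀ j'' : Fin k, j'' < j' → ∃ lab : Fin m × ℕ, (j'' :: j :: e.1, lab) ∈ S) ∧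
        (Φ e.2.1 j).1 = (Φ y j').1)) ∧
      ((∀ e ∈ S, ∀ (j : Fin k) (y : Fin m) (s : ℕ), (j :: e.1, (y, s)) ∈ S →
        s / 2 < e.2.2 / 2 ∧ ∃ j' : Fin k, ∀ lab : Fin m × ℕ, (j' :: j :: e.1, lab) ∉ S) ∧
      (∀ e ∈ S, ∀ (j : Fin k) (y : Fin m) (s : ℕ), (j :: e.1, (y, s)) ∈ S → s % 2 = 1 →
        ∀ j₁ j₂ : Fin k, (∀ lab : Fin m × ℕ, (j₁ :: j :: e.1, lab) ∉ S) →
          (∀ lab : Fin m × ℕ, (j₂ :: j :: e.1, lab) ∉ S) → j₁ = j₂) ∧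
      (∀ e ∈ S, 1 ≤ e.2.2 / 2 → ∃ (j : Fin k) (y : Fin m) (s : ℕ),
        (j :: e.1, (y, s)) ∈ S ∧ s / 2 + 1 = e.2.2 / 2)) ∧
      (∃ j : Fin k, ∀ lab : Fin m × ℕ, ([j], lab) ∉ S) ∧
      (∀ (y : Fin m) (s : ℕ), (([] : List (Fin k)), (y, s)) ∈ S → s % 2 = 1 →
        ∀ j₁ j₂ : Fin k, (∀ lab : Fin m × ℕ, ([j₁], lab) ∉ S) →
          (∀ lab : Fin m × ℕ, ([j₂], lab) ∉ S) → j₁ = j₂) ∧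
      (∀ lab : Fin m × ℕ, ([jf'], lab) ∉ S) ∧ (∀ j'' : Fin k, j'' < jf' → ∃ lab : Fin m × ℕ, ([j''], lab) ∈ S) ∧
      (Φ i j).1 = (Φ y jf').1 ∧ (((Φ i j).2 = true) ↔ r' % 2 = 0) ∧
      ((1 ≤ t ∧ val t Φ (Φ i j).1 ≠ val (t - 1) Φ (Φ i j).1) → s + 1 = t)))
    (hch2 : ∀ j : Fin k, j ≠ jf → (((1 ≤ t ∧ val t Φ (Φ i j).1 ≠ val (t - 1) Φ (Φ i j).1)) ∨ (Φ i j).2 = true) → ch j ≠ none)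
    (hch3 : ∀ j : Fin k, ch j = none → j ≠ jf → ¬ ((1 ≤ t ∧ val t Φ (Φ i j).1 ≠ val (t - 1) Φ (Φ i j).1)) ∧ (Φ i j).2 = false) :
    ∃ (T : Finset (List (Fin k) × (Fin m × ℕ))) (r : ℕ), (T ∈ TS t ∧ r / 2 = t ∧ (([] : List (Fin k)), (i, r)) ∈ T ∧
      (∀ e ∈ T, ∀ j : Fin k,
      (((Φ e.2.1 j).2 = true ↔ ((∃ (y : Fin m) (s : ℕ), (j :: e.1, (y, s)) ∈ T ∧ s % 2 = 0) ∨
        ((∀ lab : Fin m × ℕ, (j :: e.1, lab) ∉ T) ∧ e.2.2 % 2 = 1))) ∧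
      ∀ (y : Fin m) (s : ℕ), (j :: e.1, (y, s)) ∈ T → ∃ j' : Fin k,
        (∀ lab : Fin m × ℕ, (j' :: j :: e.1, lab) ∉ T) ∧
        (∀ j'' : Fin k, j'' < j' → ∃ lab : Fin m × ℕ, (j'' :: j :: e.1, lab) ∈ T) ∧
        (Φ e.2.1 j).1 = (Φ y j').1)) ∧
      ((∀ e ∈ T, ∀ (j : Fin k) (y : Fin m) (s : ℕ), (j :: e.1, (y, s)) ∈ T →
        s / 2 < e.2.2 / 2 ∧ ∃ j' : Fin k, ∀ lab : Fin m × ℕ, (j' :: j :: e.1, lab) ∉ T) ∧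
      (∀ e ∈ T, ∀ (j : Fin k) (y : Fin m) (s : ℕ), (j :: e.1, (y, s)) ∈ T → s % 2 = 1 →
        ∀ j₁ j₂ : Fin k, (∀ lab : Fin m × ℕ, (j₁ :: j :: e.1, lab) ∉ T) →
          (∀ lab : Fin m × ℕ, (j₂ :: j :: e.1, lab) ∉ T) → j₁ = j₂) ∧
      (∀ e ∈ T, 1 ≤ e.2.2 / 2 → ∃ (j : Fin k) (y : Fin m) (s : ℕ),
        (j :: e.1, (y, s)) ∈ T ∧ s / 2 + 1 = e.2.2 / 2)) ∧
      (∃ j : Fin k, ∀ lab : Fin m × ℕ, ([j], lab) ∉ T) ∧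
      (∀ (y : Fin m) (s : ℕ), (([] : List (Fin k)), (y, s)) ∈ T → s % 2 = 1 →
        ∀ j₁ j₂ : Fin k, (∀ lab : Fin m × ℕ, ([j₁], lab) ∉ T) →
          (∀ lab : Fin m × ℕ, ([j₂], lab) ∉ T) → j₁ = j₂) ∧
      (∀ j' : Fin k, (if 1 ≤ t ∧ val t Φ (Φ i jf).1 ≠ val (t - 1) Φ (Φ i jf).1 then (2 : ℕ)
          else if (Φ i jf).2 = true then 1 else 0) < (if 1 ≤ t ∧ val t Φ (Φ i j').1 ≠ val (t - 1) Φ (Φ i j').1 then (2 : ℕ)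
          else if (Φ i j').2 = true then 1 else 0) ∨
        ((if 1 ≤ t ∧ val t Φ (Φ i jf).1 ≠ val (t - 1) Φ (Φ i jf).1 then (2 : ℕ)
          else if (Φ i jf).2 = true then 1 else 0) = (if 1 ≤ t ∧ val t Φ (Φ i j').1 ≠ val (t - 1) Φ (Φ i j').1 then (2 : ℕ)
          else if (Φ i j').2 = true then 1 else 0) ∧ jf ≤ j')) ∧
      (∀ lab : Fin m × ℕ, ([jf], lab) ∉ T) ∧ (∀ j'' : Fin k, j'' < jf → ∃ lab : Fin m × ℕ, ([j''], lab) ∈ T) ∧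
      (r % 2 = 1 ↔ (Φ i jf).2 = true)) := by
  -- the code of the root
  set τ : ℕ := if (Φ i jf).2 = true then 1 else 0 with hτ
  have hτle : τ ≤ 1 := by rw [hτ]; split_ifs <;> norm_num
  have hτodd : τ = 1 ↔ (Φ i jf).2 = true := by
    rw [hτ]; split_ifs with h
    · exact ⟨fun _ => h, fun _ => rfl⟩
    · exact ⟨fun h' => absurd h' (by norm_num), fun h' => absurd h' h⟩
  set r : ℕ := 2 * t + τ with hr
  have hr2 : r / 2 = t := by omega
  have hrodd : r % 2 = 1 ↔ (Φ i jf).2 = true := by rw [← hτodd]; omega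
  have hrL : r ≤ 2 * Λ + 1 := by omega
  -- basic facts on the subtrees
  have hroots : ∀ (j : Fin k) (S : Finset (List (Fin k) × (Fin m × ℕ))), ch j = some S →
      ∃ lab : Fin m × ℕ, (([] : List (Fin k)), lab) ∈ S := by
    intro j S hS
    obtain ⟨y, s, r', jf', _, _, hroot, _⟩ := hch1 j S hS
    exact ⟨(y, r'), hroot⟩
  have hfunS : ∀ (j : Fin k) (S : Finset (List (Fin k) × (Fin m × ℕ))), ch j = some S → ∀ lab lab' : Fin m × ℕ,
      (([] : List (Fin k)), lab) ∈ S → (([] : List (Fin k)), lab') ∈ S → lab = lab' := by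
    intro j S hS
    obtain ⟨y, s, r', jf', _, hTS, _⟩ := hch1 j S hS
    exact fun lab lab' h h' => (sissR_TS_valid asm hasm TS (2 * Λ + 1) hTS0 hTSs s S hTS).2.1 [] lab lab' h h'
  -- the class of the nominee bounds every class; a negative non-recent slot forces an even code
  have hjf_class : ∀ j : Fin k, ch j = none → j ≠ jf → (Φ i jf).2 = false := by
    intro j hj hjj
    obtain ⟨hnrec, hneg⟩ := hch3 j hj hjj
    exact sissW_nom_sign_false val t Φ i jf hnom j hnrec hneg
  -- membership facts of the assembled code at depth one
  have hmem1 : ∀ (j : Fin k) (lab : Fin m × ℕ), ([j], lab) ∈ asm i r ch → ∃ S : Finset (List (Fin k) × (Fin m × ℕ)), ch j = some S ∧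
      (([] : List (Fin k)), lab) ∈ S := fun j lab h => (sissR_asm_mem_single asm hasm i r ch j lab).1 h
  have hpresent : ∀ j : Fin k, ch j ≠ none → ∃ lab : Fin m × ℕ, ([j], lab) ∈ asm i r ch := by
    intro j hj
    cases hS : ch j with
    | none => exact absurd hS hj
    | some S =>
      obtain ⟨lab, hlab⟩ := hroots j S hS
      exact ⟨lab, (sissR_asm_mem_single asm hasm i r ch j lab).2 ⟨S, hS, hlab⟩⟩
  refine ⟨asm i r ch, r, ?_, hr2, (sissR_asm_mem_nil asm hasm i r ch (i, r)).2 rfl, ?_, ?_, ?_, ?_, hnom,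
    ?_, ?_, hrodd⟩
  · -- membership in `TS t`
    rcases Nat.eq_zero_or_pos t with htz | htp
    · have hnone : ch = fun _ => none := by
        funext j
        cases hS : ch j with
        | none => rfl
        | some S =>
          obtain ⟨y, s, r', jf', hs, _⟩ := hch1 j S hS
          omega
      rw [hnone, htz]
      exact (hTS0 _).2 ⟨i, r, hrL, rfl⟩
    · have ht1 : t - 1 + 1 = t := Nat.sub_add_cancel htp
      rw [← ht1]
      refine (hTSs (t - 1) _).2 ⟨i, r, hrL, ch, fun j S hS => ?_, rfl⟩
      obtain ⟨y, s, r', jf', hs, hTS, _⟩ := hch1 j S hS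
      exact sissR_TS_mono_le asm TS (2 * Λ + 1) hTS0 hTSs s (t - 1) (by omega) S hTS
  · -- syntactic validity
    refine sissW_synv_asm asm hasm Φ i r ch (fun j => ?_) hfunS (fun j S hS => ?_)
    · by_cases hj : j = jf
      · subst hj
        constructor
        · intro h
          exact Or.inr ⟨hch0, hrodd.2 h⟩
        · rintro (⟨S, y, s, hS, _, _⟩ | ⟨_, h⟩)
          · rw [hch0] at hS; exact absurd hS (by simp)
          · exact hrodd.1 h
      · cases hS : ch j with
        | none =>
          obtain ⟨_, hneg⟩ := hch3 j hS hj
          rw [hneg]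
          constructor
          · intro h; exact absurd h (by simp)
          · rintro (⟨S, y, s, hS', _, _⟩ | ⟨_, h⟩)
            · exact absurd hS' (by simp)
            · have := hjf_class j hS hj
              rw [hrodd.1 h] at this
              exact absurd this (by simp)
        | some S =>
          obtain ⟨y, s, r', jf', _, _, hroot, _, _, _, _, _, _, _, _, hpar, _⟩ := hch1 j S hS
          rw [hpar]
          constructor
          · intro h
            exact Or.inl ⟨S, y, r', rfl, hroot, h⟩
          · rintro (⟨S', y', s', hS', hroot', hpar'⟩ | ⟨h, _⟩)
            · have hSS : S = S' := Option.some_injective _ hS'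
              subst hSS
              have := hfunS j S hS _ _ hroot hroot'
              rw [Prod.mk.injEq] at this
              rw [this.2]
              exact hpar'
            · exact absurd h (by simp)
    · obtain ⟨y, s, r', jf', _, _, hroot, _, hsyn, _, _, _, hjfno, hjflt, hedge, _⟩ := hch1 j S hS
      exact ⟨hsyn, y, r', hroot, jf', hjfno, hjflt, hedge⟩
  · -- local validity
    refine sissW_locv_asm_of asm hasm i r ch hfunS (fun j S hS => ?_) (fun h1 => ?_)
    · obtain ⟨y, s, r', jf', hs, _, hroot, hr', _, hloc, hnone, huniq, _⟩ := hch1 j S hS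
      exact ⟨hloc, hnone, huniq, y, r', hroot, by omega⟩
    · -- recency: the clause was satisfied at round `t - 1`
      have htp : 1 ≤ t := by omega
      have ht1 : t - 1 + 1 = t := Nat.sub_add_cancel htp
      have hviol' : (∀ jj : Fin k, val (t - 1 + 1) Φ (Φ i jj).1 ≠ (Φ i jj).2) := by rw [ht1]; exact hviol
      obtain ⟨j₁, hj₁⟩ := sissW_newly_violated val hvalW (by omega) (t - 1) Φ i hviol'
      rw [ht1] at hj₁
      have hrec₁ : (1 ≤ t ∧ val t Φ (Φ i j₁).1 ≠ val (t - 1) Φ (Φ i j₁).1) := ⟨htp, hj₁⟩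
      -- a recent slot other than the nominee
      obtain ⟨j₂, hj₂, hrec₂⟩ : ∃ j₂ : Fin k, j₂ ≠ jf ∧ (1 ≤ t ∧ val t Φ (Φ i j₂).1 ≠ val (t - 1) Φ (Φ i j₂).1) := by
        by_cases hj : j₁ = jf
        · -- the nominee has class `2`, hence every slot has
          subst hj
          have h2 : (if 1 ≤ t ∧ val t Φ (Φ i j₁).1 ≠ val (t - 1) Φ (Φ i j₁).1 then (2 : ℕ)
          else if (Φ i j₁).2 = true then 1 else 0) = 2 := (sissW_key_eq_two val t Φ i j₁).2 hrec₁
          set j₂ : Fin k := if (j₁ : ℕ) = 0 then ⟨1, by omega⟩ else ⟨0, by omega⟩ with hj₂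
          have hne : j₂ ≠ j₁ := by
            intro h
            have := congrArg Fin.val h
            rw [hj₂] at this
            split_ifs at this with h0
            · simp at this; omega
            · simp at this; omega
          refine ⟨j₂, hne, (sissW_key_eq_two val t Φ i j₂).1 ?_⟩
          have hle := sissW_nom_le val t Φ i j₁ hnom j₂
          have hle2 := sissW_key_le_two val t Φ i j₂
          rw [h2] at hle
          exact le_antisymm hle2 hle
        · exact ⟨j₁, hj, hrec₁⟩
      have hsome := hch2 j₂ hj₂ (Or.inl hrec₂)
      cases hS : ch j₂ with
      | none => exact absurd hS hsome
      | some S =>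
        obtain ⟨y, s, r', jf', _, _, hroot, hr', _, _, _, _, _, _, _, _, hrecs⟩ := hch1 j₂ S hS
        have hst := hrecs hrec₂
        exact ⟨j₂, S, y, r', hS, hroot, by omega⟩
  · -- a childless root slot: the nominee
    refine ⟨jf, fun lab hlab => ?_⟩
    obtain ⟨S, hS, _⟩ := hmem1 jf lab hlab
    rw [hch0] at hS
    exact absurd hS (by simp)
  · -- uniqueness of the childless root slot when the code is odd
    intro y s hys hodd j₁ j₂ hj₁ hj₂
    have hlab := (sissR_asm_mem_nil asm hasm i r ch (y, s)).1 hys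
    rw [Prod.mk.injEq] at hlab
    obtain ⟨_, rfl⟩ := hlab
    have hpos : (Φ i jf).2 = true := hrodd.1 hodd
    have hboth : ∀ j : Fin k, (∀ lab : Fin m × ℕ, ([j], lab) ∉ asm i r ch) → j = jf := by
      intro j hj
      by_contra hjj
      have hnone : ch j = none := by
        by_contra hsome
        obtain ⟨lab, hlab⟩ := hpresent j hsome
        exact hj lab hlab
      have := hjf_class j hnone hjj
      rw [hpos] at this
      exact absurd this (by simp)
    rw [hboth j₁ hj₁, hboth j₂ hj₂]
  · -- the nominee slot is childless
    intro lab hlab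
    obtain ⟨S, hS, _⟩ := hmem1 jf lab hlab
    rw [hch0] at hS
    exact absurd hS (by simp)
  · -- the slots before the nominee bear children
    intro j'' hj''
    have hlt := sissW_nom_lt val t Φ i jf hnom j'' hj''
    have hne0 : (if 1 ≤ t ∧ val t Φ (Φ i j'').1 ≠ val (t - 1) Φ (Φ i j'').1 then (2 : ℕ)
          else if (Φ i j'').2 = true then 1 else 0) ≠ 0 := by omega
    exact hpresent j'' (hch2 j'' (ne_of_lt hj'') (sissW_key_ne_zero val t Φ i j'' hne0))

/-- **Every violated clause has a good witness tree.** For every round `t ≤ Λ`, every clause violated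
at round `t` is the root — of code `2t + [nominee slot positive]` — of a code of `TS t` that is
syntactically valid in `Φ` (two-way sign rule), locally valid, whose least childless root slot is the
nominee (the only childless root slot if positive). (`k ≥ 2`; codes bounded by `2Λ + 1`.) -/
theorem sissW_build (asm : Fin m → ℕ → (Fin k → Option (Finset (List (Fin k) × (Fin m × ℕ)))) → Finset (List (Fin k) × (Fin m × ℕ)))
    (hasm : ∀ (c : Fin m) (r : ℕ) (ch : Fin k → Option (Finset (List (Fin k) × (Fin m × ℕ))))
      (e : (List (Fin k) × (Fin m × ℕ))), e ∈ asm c r ch ↔ (e = ([], (c, r)) ∨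
      ∃ (j : Fin k) (S : Finset (List (Fin k) × (Fin m × ℕ))), ch j = some S ∧
        ∃ b : List (Fin k), (b, e.2) ∈ S ∧ e.1 = b ++ [j]))
    (TS : ℕ → Finset (Finset (List (Fin k) × (Fin m × ℕ)))) (Λ : ℕ)
    (hTS0 : ∀ T : Finset (List (Fin k) × (Fin m × ℕ)), T ∈ TS 0 ↔
      ∃ (c : Fin m) (r : ℕ), r ≤ 2 * Λ + 1 ∧ T = asm c r (fun _ => none))
    (hTSs : ∀ (d : ℕ) (T : Finset (List (Fin k) × (Fin m × ℕ))), T ∈ TS (d + 1) ↔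
      ∃ (c : Fin m) (r : ℕ), r ≤ 2 * Λ + 1 ∧ ∃ ch : Fin k → Option (Finset (List (Fin k) × (Fin m × ℕ))),
        (∀ (j : Fin k) (S : Finset (List (Fin k) × (Fin m × ℕ))), ch j = some S → S ∈ TS d) ∧ T = asm c r ch)
    (val : ℕ → (Fin m → Fin k → Fin n × Bool) → Fin n → Bool)
    (hval0 : ∀ (Φ : (Fin m → Fin k → Fin n × Bool)) (v : Fin n), val 0 Φ v = true)
    (hvalW : ∀ (t : ℕ) (Φ : (Fin m → Fin k → Fin n × Bool)) (v : Fin n), val (t + 1) Φ v = val t Φ v ↔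
      ¬ (∃ ii : Fin m, (∀ jj : Fin k, val t Φ (Φ ii jj).1 ≠ (Φ ii jj).2) ∧
        ∃ jf : Fin k, (∀ j' : Fin k, (if 1 ≤ t ∧ val t Φ (Φ ii jf).1 ≠ val (t - 1) Φ (Φ ii jf).1 then (2 : ℕ)
          else if (Φ ii jf).2 = true then 1 else 0) < (if 1 ≤ t ∧ val t Φ (Φ ii j').1 ≠ val (t - 1) Φ (Φ ii j').1 then (2 : ℕ)
          else if (Φ ii j').2 = true then 1 else 0) ∨
        ((if 1 ≤ t ∧ val t Φ (Φ ii jf).1 ≠ val (t - 1) Φ (Φ ii jf).1 then (2 : ℕ)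
          else if (Φ ii jf).2 = true then 1 else 0) = (if 1 ≤ t ∧ val t Φ (Φ ii j').1 ≠ val (t - 1) Φ (Φ ii j').1 then (2 : ℕ)
          else if (Φ ii j').2 = true then 1 else 0) ∧ jf ≤ j')) ∧ (Φ ii jf).1 = v))
    (hk : 2 ≤ k) (Φ : (Fin m → Fin k → Fin n × Bool)) :
    ∀ t : ℕ, t ≤ Λ → ∀ i : Fin m, ((∀ jj : Fin k, val t Φ (Φ i jj).1 ≠ (Φ i jj).2)) →
      ∃ (T : Finset (List (Fin k) × (Fin m × ℕ))) (r : ℕ) (jf : Fin k), (T ∈ TS t ∧ r / 2 = t ∧ (([] : List (Fin k)), (i, r)) ∈ T ∧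
      (∀ e ∈ T, ∀ j : Fin k,
      (((Φ e.2.1 j).2 = true ↔ ((∃ (y : Fin m) (s : ℕ), (j :: e.1, (y, s)) ∈ T ∧ s % 2 = 0) ∨
        ((∀ lab : Fin m × ℕ, (j :: e.1, lab) ∉ T) ∧ e.2.2 % 2 = 1))) ∧
      ∀ (y : Fin m) (s : ℕ), (j :: e.1, (y, s)) ∈ T → ∃ j' : Fin k,
        (∀ lab : Fin m × ℕ, (j' :: j :: e.1, lab) ∉ T) ∧
        (∀ j'' : Fin k, j'' < j' → ∃ lab : Fin m × ℕ, (j'' :: j :: e.1, lab) ∈ T) ∧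
        (Φ e.2.1 j).1 = (Φ y j').1)) ∧
      ((∀ e ∈ T, ∀ (j : Fin k) (y : Fin m) (s : ℕ), (j :: e.1, (y, s)) ∈ T →
        s / 2 < e.2.2 / 2 ∧ ∃ j' : Fin k, ∀ lab : Fin m × ℕ, (j' :: j :: e.1, lab) ∉ T) ∧
      (∀ e ∈ T, ∀ (j : Fin k) (y : Fin m) (s : ℕ), (j :: e.1, (y, s)) ∈ T → s % 2 = 1 →
        ∀ j₁ j₂ : Fin k, (∀ lab : Fin m × ℕ, (j₁ :: j :: e.1, lab) ∉ T) →
          (∀ lab : Fin m × ℕ, (j₂ :: j :: e.1, lab) ∉ T) → j₁ = j₂) ∧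
      (∀ e ∈ T, 1 ≤ e.2.2 / 2 → ∃ (j : Fin k) (y : Fin m) (s : ℕ),
        (j :: e.1, (y, s)) ∈ T ∧ s / 2 + 1 = e.2.2 / 2)) ∧
      (∃ j : Fin k, ∀ lab : Fin m × ℕ, ([j], lab) ∉ T) ∧
      (∀ (y : Fin m) (s : ℕ), (([] : List (Fin k)), (y, s)) ∈ T → s % 2 = 1 →
        ∀ j₁ j₂ : Fin k, (∀ lab : Fin m × ℕ, ([j₁], lab) ∉ T) →
          (∀ lab : Fin m × ℕ, ([j₂], lab) ∉ T) → j₁ = j₂) ∧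
      (∀ j' : Fin k, (if 1 ≤ t ∧ val t Φ (Φ i jf).1 ≠ val (t - 1) Φ (Φ i jf).1 then (2 : ℕ)
          else if (Φ i jf).2 = true then 1 else 0) < (if 1 ≤ t ∧ val t Φ (Φ i j').1 ≠ val (t - 1) Φ (Φ i j').1 then (2 : ℕ)
          else if (Φ i j').2 = true then 1 else 0) ∨
        ((if 1 ≤ t ∧ val t Φ (Φ i jf).1 ≠ val (t - 1) Φ (Φ i jf).1 then (2 : ℕ)
          else if (Φ i jf).2 = true then 1 else 0) = (if 1 ≤ t ∧ val t Φ (Φ i j').1 ≠ val (t - 1) Φ (Φ i j').1 then (2 : ℕ)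
          else if (Φ i j').2 = true then 1 else 0) ∧ jf ≤ j')) ∧
      (∀ lab : Fin m × ℕ, ([jf], lab) ∉ T) ∧ (∀ j'' : Fin k, j'' < jf → ∃ lab : Fin m × ℕ, ([j''], lab) ∈ T) ∧
      (r % 2 = 1 ↔ (Φ i jf).2 = true)) := by
  intro t
  induction t using Nat.strong_induction_on with
  | _ t ih =>
    intro htΛ i hviol
    obtain ⟨jf, hnom⟩ := sissW_nom_exists val t Φ i (by omega)
    have hIH : (∀ s : ℕ, s < t → ∀ y : Fin m, (∀ jj : Fin k, val s Φ (Φ y jj).1 ≠ (Φ y jj).2) →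
      ∃ (T : Finset (List (Fin k) × (Fin m × ℕ))) (r : ℕ) (jf : Fin k), (T ∈ TS s ∧ r / 2 = s ∧ (([] : List (Fin k)), (y, r)) ∈ T ∧
      (∀ e ∈ T, ∀ j : Fin k,
      (((Φ e.2.1 j).2 = true ↔ ((∃ (y : Fin m) (s : ℕ), (j :: e.1, (y, s)) ∈ T ∧ s % 2 = 0) ∨
        ((∀ lab : Fin m × ℕ, (j :: e.1, lab) ∉ T) ∧ e.2.2 % 2 = 1))) ∧
      ∀ (y : Fin m) (s : ℕ), (j :: e.1, (y, s)) ∈ T → ∃ j' : Fin k,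
        (∀ lab : Fin m × ℕ, (j' :: j :: e.1, lab) ∉ T) ∧
        (∀ j'' : Fin k, j'' < j' → ∃ lab : Fin m × ℕ, (j'' :: j :: e.1, lab) ∈ T) ∧
        (Φ e.2.1 j).1 = (Φ y j').1)) ∧
      ((∀ e ∈ T, ∀ (j : Fin k) (y : Fin m) (s : ℕ), (j :: e.1, (y, s)) ∈ T →
        s / 2 < e.2.2 / 2 ∧ ∃ j' : Fin k, ∀ lab : Fin m × ℕ, (j' :: j :: e.1, lab) ∉ T) ∧
      (∀ e ∈ T, ∀ (j : Fin k) (y : Fin m) (s : ℕ), (j :: e.1, (y, s)) ∈ T → s % 2 = 1 →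
        ∀ j₁ j₂ : Fin k, (∀ lab : Fin m × ℕ, (j₁ :: j :: e.1, lab) ∉ T) →
          (∀ lab : Fin m × ℕ, (j₂ :: j :: e.1, lab) ∉ T) → j₁ = j₂) ∧
      (∀ e ∈ T, 1 ≤ e.2.2 / 2 → ∃ (j : Fin k) (y : Fin m) (s : ℕ),
        (j :: e.1, (y, s)) ∈ T ∧ s / 2 + 1 = e.2.2 / 2)) ∧
      (∃ j : Fin k, ∀ lab : Fin m × ℕ, ([j], lab) ∉ T) ∧
      (∀ (y : Fin m) (s : ℕ), (([] : List (Fin k)), (y, s)) ∈ T → s % 2 = 1 →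
        ∀ j₁ j₂ : Fin k, (∀ lab : Fin m × ℕ, ([j₁], lab) ∉ T) →
          (∀ lab : Fin m × ℕ, ([j₂], lab) ∉ T) → j₁ = j₂) ∧
      (∀ j' : Fin k, (if 1 ≤ s ∧ val s Φ (Φ y jf).1 ≠ val (s - 1) Φ (Φ y jf).1 then (2 : ℕ)
          else if (Φ y jf).2 = true then 1 else 0) < (if 1 ≤ s ∧ val s Φ (Φ y j').1 ≠ val (s - 1) Φ (Φ y j').1 then (2 : ℕ)
          else if (Φ y j').2 = true then 1 else 0) ∨
        ((if 1 ≤ s ∧ val s Φ (Φ y jf).1 ≠ val (s - 1) Φ (Φ y jf).1 then (2 : ℕ)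
          else if (Φ y jf).2 = true then 1 else 0) = (if 1 ≤ s ∧ val s Φ (Φ y j').1 ≠ val (s - 1) Φ (Φ y j').1 then (2 : ℕ)
          else if (Φ y j').2 = true then 1 else 0) ∧ jf ≤ j')) ∧
      (∀ lab : Fin m × ℕ, ([jf], lab) ∉ T) ∧ (∀ j'' : Fin k, j'' < jf → ∃ lab : Fin m × ℕ, ([j''], lab) ∈ T) ∧
      (r % 2 = 1 ↔ (Φ y jf).2 = true))) := fun s hs y hy => ih s hs (by omega) y hy
    obtain ⟨ch, hch0, hch1, hch2, hch3⟩ := sissW_build_children TS val hval0 hvalW Φ t i hviol jf hIH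
    obtain ⟨T, r, hgood⟩ := sissW_build_asm asm hasm TS Λ hTS0 hTSs val hvalW hk Φ t htΛ i hviol jf hnom
      ch hch0 hch1 hch2 hch3
    exact ⟨T, r, jf, hgood⟩

end Build

end Summit.PneNP.PneNP.Theorems
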